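import Literature.NumberTheory.Weil1964.ArchFollandTorusKType
import Literature.Analysis.SegalBargmann.HermiteOrthonormalEuclidean
import Literature.Analysis.SegalBargmann.SchwartzHermiteDegreeComponents
import HarnessLib

/-!
# A joint weight vector of the FULL oscillator torus is a multiple of ONE Hermite function (weight spaces are lines)

Topic `NumberTheory/Weil1964` (§2, the Folland-frame ∕ implementer-family currency of `ArchFollandTorusKType`) over
`Analysis/SegalBargmann` (§1, the abstract oscillator torus `torusOpCLM θ = e^{iθ·N}` of `HermiteOscillatorTorus`).
KERNEL ONLY: theorems, no definition, no named fact, no `sorry`, no instance, no notation.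

WHAT.  [Folland1989, §1.7]: the Hermite functions `h_β`, `β ∈ ℕ^σ`, are the joint eigenfunctions of the oscillator torus
`U(θ) = e^{iθ·N}`, `θ ∈ ℝ^σ`, with characters `θ ↦ e^{iθ·β}` (★ `torusOpCLM_herm`, ★ `torusOpPi_hermitePi`, ★
`arch_torus_apply_follandHermite`).  This file proves the CONVERSE, i.e. the weight-space statement: since the characters
`e^{iθ·β}` are pairwise distinct (`eq_of_forall_torusPhase_eq`) and a Schwartz function is determined by its Hermite
coefficients (★ `ext_hermiteCoeff`, `c_α(U(θ)f) = e^{iθ·α} c_α(f)` ★ `hermiteCoeff_torusOpCLM`),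
* §1 `exists_eq_smul_herm_of_forall_torusOpCLM` — a Schwartz function on `ℝ^σ` that is an eigenvector of EVERY `U(θ)`
  is `c • h_β` for one `β`; `exists_forall_mem_span_herm_of_torusOpCLM` — for a fixed eigencharacter `χ : ℝ^σ → ℂ` ALL
  such eigenvectors lie on ONE line `ℂ h_β` (the `χ`-weight space has dimension `≤ 1`); and the degree blocks
  `degBlock d = span {h_β : |β| = d}` (★ `SchwartzHermiteDegreeComponents`) are finite-dimensional (`finiteDimensional_degBlock`);
* §2 the same on any Folland carrier `𝓢(D, ℂ)` along a frame `e : D ≃L[ℝ] ℝ^σ` (`follandHermite e β = (e^*)⁻¹ h_β`,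
  `torusOpPi`): `exists_eq_smul_follandHermite_of_forall_torusOpPi`, `exists_forall_mem_span_follandHermite_of_torusOpPi`, and in
  the FAMILY currency of ★ `family_apply_eq_vacCoeff_smul` (a family `k ↦ A k` of operators of `𝓢(D)` exactly `rhoSD e`-covariant
  over the rotations `realify (diagHom (torusPt (φ k)))` with transports lifting to unitaries `U k`): if the phase map
  `φ : H → ℝ^σ` is ONTO (the full torus), every simultaneous eigenvector of the family is `c • follandHermite e β`
  (`family_eigenvector_eq_smul_follandHermite`), and every simultaneous eigencharacter has its weight space inside one line
  (`family_exists_forall_mem_span_follandHermite`).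

WHY (cell `hodgecm-mathlib`, crux `hLiu418` = stmt-HodgeConjecture-24832, line LD1, organ (Gβ) «admissible slice of the
theta span», brick (Gβ1-arch) of LD1-plan's blueprint v1 §3 (viii)): at an archimedean place the torus weight `κ` of the
slice pins ONE Hermite index `β(κ)` — the archimedean factor of the `(κ, K_f)`-slice of [Liu2021, Def. 4.11]'s `ω(μ, ε, χ)`
is at most a line; the finite-adelic factor is finite-dimensional by ★ `Def411WeilCarriersAdmissibleAtLine` (brick (Gβ1-fin)).
Nothing of [Liu2021] is asserted here; HC_CM is proved only modulo the 7 printed citations until rung 0 closes, and this file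
discharges none of them (a `--supports` helper).

## References
* [Folland1989] G. B. Folland, *Harmonic Analysis in Phase Space*, Annals of Math. Studies 122 (1989): §1.7 (the Hermite
  functions (1.81) as joint eigenfunctions of `e^{iθ·N}`), Prop. (4.39) (the metaplectic representation on the torus).
-/

set_option autoImplicit false

noncomputable section

open scoped Matrix SchwartzMap Real InnerProductSpace
open MeasureTheory Complex
open Literature.RepresentationTheory.HeisenbergGroup Literature.Analysis.SegalBargmann

/-! ## §1 The abstract oscillator torus `torusOpCLM θ = e^{iθ·N}` on `𝓢(ℝ^σ, ℂ)` (Euclidean carrier) -/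

namespace Literature.Analysis.SegalBargmann

section Euclidean

variable {σ : Type*} [Fintype σ] [DecidableEq σ]

/-- `e^{i (t e_j)·β} = e^{i t β_j}`: the torus phase at a coordinate angle. [cite: Folland1989, §1.7] -/
theorem torusPhase_single (j : σ) (t : ℝ) (β : σ →₀ ℕ) :
    torusPhase (Pi.single j t : σ → ℝ) β = Complex.exp (((t * (β j : ℝ) : ℝ) : ℂ) * I) := by
  rw [torusPhase]
  congr 3
  rw [Finset.sum_eq_single j (fun k _ hk => by rw [Pi.single_eq_of_ne hk, zero_mul]) (fun h => absurd (Finset.mem_univ j) h),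
    Pi.single_eq_same]

omit [DecidableEq σ] in
/-- **The torus characters `θ ↦ e^{iθ·β}` are pairwise distinct**: `e^{iθ·α} = e^{iθ·β}` for all `θ ∈ ℝ^σ` forces `α = β`
(test at `θ = (π ∕ (α_j − β_j)) e_j`, where the quotient would be `e^{iπ} = −1`). [cite: Folland1989, §1.7] -/
theorem eq_of_forall_torusPhase_eq {α β : σ →₀ ℕ} (h : ∀ θ : σ → ℝ, torusPhase θ α = torusPhase θ β) : α = β := by
  classical
  ext j
  by_contra hne
  have hd : ((α j : ℝ) - (β j : ℝ)) ≠ 0 := sub_ne_zero.2 (by exact_mod_cast hne)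
  set t : ℝ := Real.pi / ((α j : ℝ) - (β j : ℝ)) with ht
  have h1 := h (Pi.single j t)
  rw [torusPhase_single, torusPhase_single] at h1
  -- `e^{i t α_j} = e^{i t β_j}` ⇒ `e^{i t (α_j − β_j)} = 1`, but `t (α_j − β_j) = π`
  have h2 : Complex.exp (((t * ((α j : ℝ) - (β j : ℝ)) : ℝ) : ℂ) * I) = 1 := by
    have hβ0 : Complex.exp (((t * (β j : ℝ) : ℝ) : ℂ) * I) ≠ 0 := Complex.exp_ne_zero _
    have h3 : Complex.exp (((t * (α j : ℝ) : ℝ) : ℂ) * I) * (Complex.exp (((t * (β j : ℝ) : ℝ) : ℂ) * I))⁻¹ = 1 := by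
      rw [h1, mul_inv_cancel₀ hβ0]
    rw [← Complex.exp_neg, ← Complex.exp_add] at h3
    rw [← h3]
    congr 1
    push_cast
    ring
  have h4 : t * ((α j : ℝ) - (β j : ℝ)) = Real.pi := by
    rw [ht, div_mul_cancel₀ _ hd]
  rw [h4, Complex.exp_pi_mul_I] at h2
  norm_num at h2

/-- **An eigenvector of `U(θ)` with a non-zero `α`-th Hermite coefficient has eigenvalue `e^{iθ·α}`.** [cite: Folland1989, §1.7] -/
theorem eq_torusPhase_of_torusOpCLM_eq_smul {f : 𝓢(EuclideanSpace ℝ σ, ℂ)} {θ : σ → ℝ} {c : ℂ}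
    (hf : torusOpCLM θ f = c • f) {α : σ →₀ ℕ} (hα : hermiteCoeff α f ≠ 0) : c = torusPhase θ α := by
  have h := congrArg (hermiteCoeff α) hf
  rw [hermiteCoeff_torusOpCLM, hermiteCoeff_smul] at h
  exact (mul_right_cancel₀ hα h).symm

/-- **A joint eigenvector of the full torus has at most ONE non-zero Hermite coefficient.** [cite: Folland1989, §1.7] -/
theorem hermiteCoeff_index_unique_of_forall_torusOpCLM {f : 𝓢(EuclideanSpace ℝ σ, ℂ)}
    (hf : ∀ θ : σ → ℝ, ∃ c : ℂ, torusOpCLM θ f = c • f) {α β : σ →₀ ℕ} (hα : hermiteCoeff α f ≠ 0)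
    (hβ : hermiteCoeff β f ≠ 0) : α = β :=
  eq_of_forall_torusPhase_eq fun θ => by
    obtain ⟨c, hc⟩ := hf θ
    rw [← eq_torusPhase_of_torusOpCLM_eq_smul hc hα, ← eq_torusPhase_of_torusOpCLM_eq_smul hc hβ]

/-- **A joint eigenvector of the FULL oscillator torus `θ ↦ e^{iθ·N}` on `𝓢(ℝ^σ, ℂ)` is a multiple of ONE Hermite function**:
`f = c_β(f) • h_β` (the converse of ★ `torusOpCLM_herm`; `f = 0` allowed, then `c = 0`). [cite: Folland1989, §1.7] -/
theorem exists_eq_smul_herm_of_forall_torusOpCLM {f : 𝓢(EuclideanSpace ℝ σ, ℂ)}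
    (hf : ∀ θ : σ → ℝ, ∃ c : ℂ, torusOpCLM θ f = c • f) :
    ∃ (β : σ →₀ ℕ) (c : ℂ), f = c • hermiteSchwartz (herm β) := by
  by_cases h0 : ∀ α : σ →₀ ℕ, hermiteCoeff α f = 0
  · exact ⟨0, 0, by rw [eq_zero_of_forall_hermiteCoeff_eq_zero f h0, zero_smul]⟩
  obtain ⟨β, hβ⟩ := not_forall.1 h0
  refine ⟨β, hermiteCoeff β f, ext_hermiteCoeff fun γ => ?_⟩
  rw [hermiteCoeff_smul, hermiteCoeff_herm]
  by_cases hγ : γ = β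
  · subst hγ; rw [if_pos rfl, mul_one]
  · rw [if_neg hγ, mul_zero]
    by_contra hγ0
    exact hγ (hermiteCoeff_index_unique_of_forall_torusOpCLM hf hγ0 hβ)

/-- **A non-zero joint eigenvector with a non-zero `β`-th coefficient IS `c_β • h_β`** (the index is pinned). [cite: Folland1989, §1.7] -/
theorem eq_smul_herm_of_forall_torusOpCLM_of_hermiteCoeff_ne_zero {f : 𝓢(EuclideanSpace ℝ σ, ℂ)}
    (hf : ∀ θ : σ → ℝ, ∃ c : ℂ, torusOpCLM θ f = c • f) {β : σ →₀ ℕ} (hβ : hermiteCoeff β f ≠ 0) :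
    f = hermiteCoeff β f • hermiteSchwartz (herm β) := by
  obtain ⟨β', c, hc⟩ := exists_eq_smul_herm_of_forall_torusOpCLM hf
  have hββ' : β = β' := by
    by_contra hne
    apply hβ
    rw [hc, hermiteCoeff_smul, hermiteCoeff_herm, if_neg hne, mul_zero]
  subst hββ'
  have hcoef : hermiteCoeff β f = c := by
    rw [hc, hermiteCoeff_smul, hermiteCoeff_herm, if_pos rfl, mul_one]
  rw [hcoef]
  exact hc

/-- **Weight spaces of the full torus are LINES**: for a fixed eigencharacter `χ : ℝ^σ → ℂ`, ALL joint eigenvectors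
`U(θ) f = χ(θ) f` lie on one line `ℂ h_β` (if one of them is non-zero, `χ = e^{iθ·β}` pins `β`; otherwise any `β` serves).
[cite: Folland1989, §1.7] -/
theorem exists_forall_mem_span_herm_of_torusOpCLM (χ : (σ → ℝ) → ℂ) :
    ∃ β : σ →₀ ℕ, ∀ f : 𝓢(EuclideanSpace ℝ σ, ℂ), (∀ θ : σ → ℝ, torusOpCLM θ f = χ θ • f) →
      f ∈ (ℂ ∙ hermiteSchwartz (herm β)) := by
  by_cases hex : ∃ g : 𝓢(EuclideanSpace ℝ σ, ℂ), (∀ θ : σ → ℝ, torusOpCLM θ g = χ θ • g) ∧ g ≠ 0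
  · obtain ⟨g, hg, hg0⟩ := hex
    obtain ⟨β, hβ⟩ : ∃ β : σ →₀ ℕ, hermiteCoeff β g ≠ 0 := by
      by_contra h
      exact hg0 (eq_zero_of_forall_hermiteCoeff_eq_zero g fun α => not_not.1 fun hα => h ⟨α, hα⟩)
    have hχ : ∀ θ, χ θ = torusPhase θ β := fun θ => eq_torusPhase_of_torusOpCLM_eq_smul (hg θ) hβ
    refine ⟨β, fun f hf => ?_⟩
    obtain ⟨β', c, hc⟩ := exists_eq_smul_herm_of_forall_torusOpCLM (f := f) fun θ => ⟨χ θ, hf θ⟩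
    by_cases hc0 : c = 0
    · rw [hc, hc0, zero_smul]; exact Submodule.zero_mem _
    · have hβ' : hermiteCoeff β' f ≠ 0 := by
        rw [hc, hermiteCoeff_smul, hermiteCoeff_herm, if_pos rfl, mul_one]; exact hc0
      have hχ' : ∀ θ, χ θ = torusPhase θ β' := fun θ => eq_torusPhase_of_torusOpCLM_eq_smul (hf θ) hβ'
      have hββ' : β = β' := eq_of_forall_torusPhase_eq fun θ => (hχ θ).symm.trans (hχ' θ)
      subst hββ'
      rw [hc]
      exact Submodule.smul_mem _ _ (Submodule.mem_span_singleton_self _)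
  · refine ⟨0, fun f hf => ?_⟩
    have hf0 : f = 0 := by
      by_contra h
      exact hex ⟨f, hf, h⟩
    rw [hf0]
    exact Submodule.zero_mem _

/-- **The degree blocks `V_d = span {h_β : |β| = d}` are finite-dimensional** (`{β ∈ ℕ^σ : |β| = d}` is finite).
[cite: Folland1989, §1.7] -/
theorem finiteDimensional_degBlock (d : ℕ) :
    FiniteDimensional ℂ ↥(degBlock (σ := σ) d) := by
  haveI : Finite {β : σ →₀ ℕ // β.degree = d} := (Finsupp.finite_of_degree_eq (σ := σ) d).to_subtype
  exact FiniteDimensional.span_of_finite ℂ (Set.finite_range _)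

end Euclidean

end Literature.Analysis.SegalBargmann

/-! ## §2 On a Folland carrier `𝓢(D, ℂ)` along a frame `e : D ≃L[ℝ] ℝ^σ`; the implementer-family currency -/

namespace Literature.NumberTheory.Weil1964

section Folland

variable {σ : Type*} [Fintype σ] [DecidableEq σ]
variable {D : Type*} [NormedAddCommGroup D] [NormedSpace ℝ D]

/-- `torusOpPi` (the torus on the Folland carrier `ℝ^σ`) read back on the Euclidean carrier: an eigenvector equation for
`torusOpPi θ` is one for `torusOpCLM θ` after `(euclE^*)⁻¹`. [cite: Folland1989, §1.7] -/
theorem torusOpCLM_symm_eq_smul_of_torusOpPi_eq_smul {g : 𝓢((σ → ℝ), ℂ)} {θ : σ → ℝ} {c : ℂ}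
    (hg : torusOpPi θ g = c • g) :
    torusOpCLM θ ((schwartzTransport (euclE σ)).symm g) = c • (schwartzTransport (euclE σ)).symm g := by
  apply (schwartzTransport (euclE σ)).injective
  rw [map_smul, ContinuousLinearEquiv.apply_symm_apply, ← torusOpPi_apply, hg]

/-- **On a Folland carrier: a joint eigenvector of the full torus `θ ↦ torusOpPi θ` (read through the frame `e`) is a
multiple of ONE `follandHermite e β`.** [cite: Folland1989, §1.7] -/
theorem exists_eq_smul_follandHermite_of_forall_torusOpPi (e : D ≃L[ℝ] (σ → ℝ)) {Φ : 𝓢(D, ℂ)}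
    (hΦ : ∀ θ : σ → ℝ, ∃ c : ℂ, torusOpPi θ (schwartzTransport e Φ) = c • schwartzTransport e Φ) :
    ∃ (β : σ →₀ ℕ) (c : ℂ), Φ = c • follandHermite e β := by
  obtain ⟨β, c, hc⟩ := exists_eq_smul_herm_of_forall_torusOpCLM
    (f := (schwartzTransport (euclE σ)).symm (schwartzTransport e Φ)) fun θ => by
      obtain ⟨c, hc⟩ := hΦ θ
      exact ⟨c, torusOpCLM_symm_eq_smul_of_torusOpPi_eq_smul hc⟩
  refine ⟨β, c, ?_⟩
  have h1 : schwartzTransport e Φ = c • hermitePi β := by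
    have h2 := congrArg (schwartzTransport (euclE σ)) hc
    rw [ContinuousLinearEquiv.apply_symm_apply, map_smul, schwartzTransport_hermiteSchwartz] at h2
    exact h2
  apply (schwartzTransport e).injective
  rw [h1, map_smul, follandHermite, ContinuousLinearEquiv.apply_symm_apply]

/-- **On a Folland carrier: weight spaces of the full torus are LINES** `ℂ • follandHermite e β`. [cite: Folland1989, §1.7] -/
theorem exists_forall_mem_span_follandHermite_of_torusOpPi (e : D ≃L[ℝ] (σ → ℝ)) (χ : (σ → ℝ) → ℂ) :
    ∃ β : σ →₀ ℕ, ∀ Φ : 𝓢(D, ℂ), (∀ θ : σ → ℝ, torusOpPi θ (schwartzTransport e Φ) = χ θ • schwartzTransport e Φ) →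
      Φ ∈ (ℂ ∙ follandHermite e β) := by
  obtain ⟨β, hβ⟩ := exists_forall_mem_span_herm_of_torusOpCLM (σ := σ) χ
  refine ⟨β, fun Φ hΦ => ?_⟩
  have hmem := hβ ((schwartzTransport (euclE σ)).symm (schwartzTransport e Φ)) fun θ =>
    torusOpCLM_symm_eq_smul_of_torusOpPi_eq_smul (hΦ θ)
  obtain ⟨c, hc⟩ := Submodule.mem_span_singleton.1 hmem
  have h1 : schwartzTransport e Φ = c • hermitePi β := by
    have h2 := congrArg (schwartzTransport (euclE σ)) hc
    rw [map_smul, schwartzTransport_hermiteSchwartz, ContinuousLinearEquiv.apply_symm_apply] at h2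
    exact h2.symm
  have h3 : Φ = c • follandHermite e β := by
    apply (schwartzTransport e).injective
    rw [h1, map_smul, follandHermite, ContinuousLinearEquiv.apply_symm_apply]
  rw [h3]
  exact Submodule.smul_mem _ _ (Submodule.mem_span_singleton_self _)

/-- **Family currency** (the hypotheses of ★ `family_apply_eq_vacCoeff_smul` VERBATIM, plus «the phases fill the torus»):
let `k ↦ A k` be a family of operators of `𝓢(D)`, each exactly `rhoSD e`-covariant over the rotation
`realify (diagHom (torusPt (φ k)))` with transports lifting to unitaries `U k` of `L²(ℝ^σ)`, and let `φ : H → ℝ^σ` be ONTO.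
Then every SIMULTANEOUS EIGENVECTOR of the family is a multiple of ONE `follandHermite e β` (converse of ★
`family_apply_follandHermite`; the vacuum coefficients are unimodular, ★ `IsRhoCovariant.norm_vacCoeff`).
[cite: Folland1989, §1.7, Prop (4.39)] -/
theorem family_eigenvector_eq_smul_follandHermite (e : D ≃L[ℝ] (σ → ℝ)) {H : Type*} {A : H → (𝓢(D, ℂ) →ₗ[ℂ] 𝓢(D, ℂ))}
    {φ : H → σ → ℝ}
    (hA : ∀ (k : H) (p q : σ → ℝ) (f : 𝓢(D, ℂ)), A k (rhoSD e p q f) =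
      rhoSD e (realify (diagHom (torusPt (φ k))) (p, q)).1 (realify (diagHom (torusPt (φ k))) (p, q)).2 (A k f))
    (U : H → ((Lp ℂ 2 (volume : Measure (σ → ℝ))) ≃ₗᵢ[ℂ] Lp ℂ 2 (volume : Measure (σ → ℝ))))
    (hU : ∀ k, LiftsTo (opTransport e (A k)) (liftCLM U k))
    (hφ : Function.Surjective φ) {Φ : 𝓢(D, ℂ)} (hΦ : ∀ k : H, ∃ c : ℂ, A k Φ = c • Φ) :
    ∃ (β : σ →₀ ℕ) (c : ℂ), Φ = c • follandHermite e β := by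
  refine exists_eq_smul_follandHermite_of_forall_torusOpPi e fun θ => ?_
  obtain ⟨k, rfl⟩ := hφ θ
  obtain ⟨c, hc⟩ := hΦ k
  have hvac : vacCoeff U k ≠ 0 := fun h0 => by
    have h1 := (family_isRhoCovariant_lift e hA U hU).norm_vacCoeff k
    rw [h0, norm_zero] at h1
    exact zero_ne_one h1
  refine ⟨(vacCoeff U k)⁻¹ * c, ?_⟩
  have h2 := family_apply_eq_vacCoeff_smul e hA U hU k Φ
  rw [hc] at h2
  -- `c • Φ = vac • (e^*)⁻¹ (torusOpPi (φ k) (e^* Φ))`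
  have h3 : (schwartzTransport e).symm (torusOpPi (φ k) (schwartzTransport e Φ)) = ((vacCoeff U k)⁻¹ * c) • Φ := by
    rw [mul_smul, h2, smul_smul, inv_mul_cancel₀ hvac, one_smul]
  have h4 := congrArg (schwartzTransport e) h3
  rw [ContinuousLinearEquiv.apply_symm_apply, map_smul] at h4
  exact h4

/-- **Family currency, weight spaces are LINES**: under the same hypotheses, for every simultaneous eigencharacter
`c : H → ℂ` ALL solutions of `A k Φ = c k • Φ` (`k ∈ H`) lie on one line `ℂ • follandHermite e β` — the `c`-weight space of the
family has dimension `≤ 1`. [cite: Folland1989, §1.7, Prop (4.39)] -/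
theorem family_exists_forall_mem_span_follandHermite (e : D ≃L[ℝ] (σ → ℝ)) {H : Type*}
    {A : H → (𝓢(D, ℂ) →ₗ[ℂ] 𝓢(D, ℂ))} {φ : H → σ → ℝ}
    (hA : ∀ (k : H) (p q : σ → ℝ) (f : 𝓢(D, ℂ)), A k (rhoSD e p q f) =
      rhoSD e (realify (diagHom (torusPt (φ k))) (p, q)).1 (realify (diagHom (torusPt (φ k))) (p, q)).2 (A k f))
    (U : H → ((Lp ℂ 2 (volume : Measure (σ → ℝ))) ≃ₗᵢ[ℂ] Lp ℂ 2 (volume : Measure (σ → ℝ))))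
    (hU : ∀ k, LiftsTo (opTransport e (A k)) (liftCLM U k))
    (hφ : Function.Surjective φ) (c : H → ℂ) :
    ∃ β : σ →₀ ℕ, ∀ Φ : 𝓢(D, ℂ), (∀ k : H, A k Φ = c k • Φ) → Φ ∈ (ℂ ∙ follandHermite e β) := by
  classical
  -- the eigencharacter of the torus operators themselves, read through a section of `φ`
  let s : (σ → ℝ) → H := fun θ => (hφ θ).choose
  have hs : ∀ θ, φ (s θ) = θ := fun θ => (hφ θ).choose_spec
  have hvac : ∀ k, vacCoeff U k ≠ 0 := fun k h0 => by
    have h1 := (family_isRhoCovariant_lift e hA U hU).norm_vacCoeff k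
    rw [h0, norm_zero] at h1
    exact zero_ne_one h1
  obtain ⟨β, hβ⟩ := exists_forall_mem_span_follandHermite_of_torusOpPi e (fun θ => (vacCoeff U (s θ))⁻¹ * c (s θ))
  refine ⟨β, fun Φ hΦ => hβ Φ fun θ => ?_⟩
  have h2 := family_apply_eq_vacCoeff_smul e hA U hU (s θ) Φ
  rw [hΦ (s θ), hs θ] at h2
  have h3 : (schwartzTransport e).symm (torusOpPi θ (schwartzTransport e Φ)) = ((vacCoeff U (s θ))⁻¹ * c (s θ)) • Φ := by
    rw [mul_smul, h2, smul_smul, inv_mul_cancel₀ (hvac _), one_smul]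
  have h4 := congrArg (schwartzTransport e) h3
  rw [ContinuousLinearEquiv.apply_symm_apply, map_smul] at h4
  exact h4

end Folland

end Literature.NumberTheory.Weil1964

end
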